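import Literature.NumberTheory.LFunctions.ClassGroupLogFreeMiddleRange
import HarnessLib

/-!
# The size of the mean value constant `h_K · M` in every degree (log-free saving)

Topic `Literature/NumberTheory/LFunctions`, namespace `Literature.NumberTheory.LFunctions.NumberField`.
Everything here is PROVED (theorems only; no definitions, no named facts).

The tree's numerical bounds behind the log-free mean value theorem for `Ĉl_K`
(`ClassGroupLogFreeSieveConst.lean`: `majorConst_two_mul_le`, `balancePoint_le`, `secondary_le`; and
`lemmaAHeight_le` of `ClassGroupLogFreeMiddleRange.lean`) are stated for number fields of degree `n_K ≤ 4`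
with absolute constants (`e^{40} T'^{15}`, `100 log P`, `P^{111} N_X^{−1/8}` with the sieve parameter
`z = N_X^{1/8}`, `84839040 log P`).  This file gives the same bounds for `n_K ≤ n`, ANY `n`, with constants
depending on `n` (and the sieve parameter `z = N_X^{1/(2n+4)}`, so that `z^{2n_K+3} ≤ N_X` still beats the
factor `N_X^{−3/2}` of the error term):

* `discBound_le_of_le`, `lemmaAHeight_le_of_le` — `M_K(v) ≤ 10(n+1) log P`, `ℒ'_v ≤ 3888000 (n+1)² log P`;
* `majorConst_two_mul_le_of_le` — `majorConst (2T') (n_K+3) (n_K+1) ≤ e^{7n+20} T'^{2n+7}`;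
* `balancePoint_le_of_le` — `u₀ ≤ 40(n+1) log P`;
* `secondary_le_of_le` — the secondary term is `≤ e^{12n+30} P^{2n+9} N_X^{−1/(2n+4)}` once `z^{2n+4} ≤ N_X`;
* `log_le_div_of_sq_le` — `log t ≤ t/M` for `t ≥ 4M²`;
* `card_mul_meanValueConst_le_param (n)` — **the packaged saving**: there are `D, C_M > 0` depending only on
  `n` such that for `n_K ≤ n`, `P ≥ 2` with `|d_K|, h_K ≤ P`, `κ_K ≥ 1/P`, `1 ≤ T' ≤ 2P`, `a₀ L_x ≥ D log P`,
  `x = e^{L_x}`, `x^{a₀}/2 ≤ N_X ≤ x^{a₀}` and `z = ⌊N_X^{1/(2n+4)}⌋`: `1 ≤ z ≤ N_X`, `z ≤ x^{a₀/2}` and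
  `h_K · M(2T', n_K+3, z, N_X) ≤ C_M/L_x` — the input of the middle range of Théorème 14 in every degree.

## References

* [ThornerZaman2017] J. Thorner, A. Zaman, Algebra Number Theory 11 (2017), Theorem 4.2, (4-4).
* [Weiss1983] A. Weiss, J. reine angew. Math. 338 (1983) 56–94, §1 (the log-free large sieve).
-/

noncomputable section

open Real Finset Filter
open scoped Topology

namespace Literature.NumberTheory.LFunctions.NumberField

open Literature.NumberTheory.LFunctions.LogFreeDensity Literature.NumberTheory.LFunctions.WeissKernel
open scoped nonZeroDivisors _root_.NumberField Classical

variable {K : Type*} [Field K] [NumberField K]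

/-! ### Heights -/

/-- **`M_K(v) ≤ 10(n+1) log P`** for `n_K ≤ n`, `|d_K| ≤ P`, `P ≥ 2`, `|v| ≤ P + 2`. [folklore] -/
theorem discBound_le_of_le {n : ℕ} (hn : Module.finrank ℚ K ≤ n) {P : ℝ} (hP : 2 ≤ P)
    (hd : ((NumberField.discr K).natAbs : ℝ) ≤ P) {v : ℝ} (hv : |v| ≤ P + 2) :
    discBound K v ≤ 10 * ((n : ℝ) + 1) * Real.log P := by
  set Lp := Real.log P with hLp
  have hP0 : 0 < P := by linarith
  have hl2 : (0.69 : ℝ) ≤ Lp := by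
    have := Real.log_two_gt_d9; have := Real.log_le_log (by norm_num) hP; rw [hLp]; linarith
  have hnr : (Module.finrank ℚ K : ℝ) ≤ n := by exact_mod_cast hn
  have hn0 : (0 : ℝ) ≤ Module.finrank ℚ K := Nat.cast_nonneg _
  have hd1 : (1 : ℝ) ≤ ((NumberField.discr K).natAbs : ℝ) := one_le_natAbs_discr
  have hlogd : Real.log ((NumberField.discr K).natAbs : ℝ) ≤ Lp := Real.log_le_log (by linarith) hd
  have hlogv : Real.log (|v| + 7) ≤ 4 * Lp := by
    have h1 : Real.log (|v| + 7) ≤ Real.log (6 * P) := Real.log_le_log (by positivity) (by linarith)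
    rw [Real.log_mul (by norm_num) hP0.ne'] at h1
    have h6 : Real.log 6 ≤ 2 := by
      have : Real.log 6 ≤ Real.log (Real.exp 2) := by
        refine Real.log_le_log (by norm_num) ?_
        have := Real.exp_one_gt_d9
        have h : Real.exp 2 = Real.exp 1 * Real.exp 1 := by rw [← Real.exp_add]; norm_num
        rw [h]; nlinarith
      rwa [Real.log_exp] at this
    linarith
  have hlv0 : 0 ≤ Real.log (|v| + 7) := le_trans zero_le_one (one_le_log_abs_add_seven v)
  rw [discBound]
  have hnLp : (n : ℝ) * 0.69 ≤ (n : ℝ) * Lp := mul_le_mul_of_nonneg_left hl2 (Nat.cast_nonneg n)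
  have h3 : 3 * (Module.finrank ℚ K : ℝ) ≤ 5 * (n : ℝ) * Lp := by linarith
  have h4 : ((Module.finrank ℚ K : ℝ) + 1) * Real.log (|v| + 7) ≤ ((n : ℝ) + 1) * (4 * Lp) :=
    mul_le_mul (by linarith) hlogv hlv0 (by positivity)
  have hnLp0 : 0 ≤ (n : ℝ) * Lp := by positivity
  linarith

/-- **`ℒ'_v ≤ 3888000 (n+1)² log P`** for `n_K ≤ n`, `|d_K| ≤ P`, `P ≥ 2`, `|v| ≤ P + 1`. [folklore] -/
theorem lemmaAHeight_le_of_le {n : ℕ} (hn : Module.finrank ℚ K ≤ n) {P : ℝ} (hP : 2 ≤ P)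
    (hd : ((NumberField.discr K).natAbs : ℝ) ≤ P) {v : ℝ} (hv : |v| ≤ P + 1) :
    lemmaAHeight K v ≤ 3888000 * ((n : ℝ) + 1) ^ 2 * Real.log P := by
  have hdisc := discBound_le_of_le hn hP hd (show |v| ≤ P + 2 by linarith)
  have hnr : (Module.finrank ℚ K : ℝ) ≤ n := by exact_mod_cast hn
  rw [lemmaAHeight]
  have hcoef : 77760 * (5 * (Module.finrank ℚ K : ℝ) + 2) + 217440 ≤ 388800 * ((n : ℝ) + 1) := by linarith
  have hdb0 : 0 ≤ discBound K v := le_trans zero_le_one (one_le_discBound K v)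
  have hP0 : (0 : ℝ) ≤ Real.log P := Real.log_nonneg (by linarith)
  calc (77760 * (5 * (Module.finrank ℚ K : ℝ) + 2) + 217440) * discBound K v
      ≤ 388800 * ((n : ℝ) + 1) * (10 * ((n : ℝ) + 1) * Real.log P) :=
        mul_le_mul hcoef hdisc hdb0 (by positivity)
    _ = 3888000 * ((n : ℝ) + 1) ^ 2 * Real.log P := by ring

/-! ### The majorant constant, the balancing point and the secondary term -/

/-- `majorConst (2T') (n_K+3) (n_K+1) ≤ e^{7n+20} T'^{2n+7}` for `n_K ≤ n`, `T' ≥ 1`. [folklore] -/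
theorem majorConst_two_mul_le_of_le {nK n : ℕ} (hn : nK ≤ n) {T' : ℝ} (hT : 1 ≤ T') :
    majorConst (2 * T') (nK + 3) (nK + 1) ≤ Real.exp (7 * n + 20) * T' ^ (2 * n + 7) := by
  rw [majorConst]
  have hT0 : 0 < T' := by linarith
  have hmax : max 1 (2 * T') = 2 * T' := max_eq_right (by linarith)
  rw [hmax]
  have hnr : (nK : ℝ) ≤ n := by exact_mod_cast hn
  have hn0 : (0 : ℝ) ≤ nK := Nat.cast_nonneg _
  -- the exponential factor `≤ e^{n+3}`
  have h1 : Real.exp (3 * ((nK + 3 : ℕ) + 1) / (2 * (2 * T'))) ≤ Real.exp ((n : ℝ) + 3) := by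
    refine Real.exp_le_exp.mpr ?_
    rw [div_le_iff₀ (by positivity)]
    push_cast
    have : 0 ≤ ((n : ℝ) + 3) * (T' - 1) := mul_nonneg (by positivity) (by linarith)
    linarith
  -- `(11/2)^{nK+1} ≤ e^{2(n+1)}`
  have h2 : ((11 : ℝ) / 2) ^ (nK + 1) ≤ Real.exp (2 * ((n : ℝ) + 1)) := by
    calc ((11 : ℝ) / 2) ^ (nK + 1) ≤ ((11 : ℝ) / 2) ^ (n + 1) := pow_le_pow_right₀ (by norm_num) (by omega)
      _ ≤ Real.exp (2 * ((n : ℝ) + 1)) := by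
          have := pow_le_exp_mul (c := 11 / 2) (m := 2) (by norm_num) (by norm_num) (n + 1)
          push_cast at this
          exact this
  -- `(1 + 2T')^{2nK+7} ≤ (3T')^{2n+7}`
  have h3 : (1 + 2 * T') ^ ((nK + 3) + (nK + 1) + 3) ≤ (3 * T') ^ (2 * n + 7) := by
    calc (1 + 2 * T') ^ ((nK + 3) + (nK + 1) + 3) ≤ (3 * T') ^ ((nK + 3) + (nK + 1) + 3) :=
          pow_le_pow_left₀ (by positivity) (by linarith) _
      _ ≤ (3 * T') ^ (2 * n + 7) := pow_le_pow_right₀ (by linarith) (by omega)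
  have h4 : (3 : ℝ) ^ (2 * n + 7) ≤ Real.exp (2 * ((2 * n + 7 : ℕ) : ℝ)) := by
    have := pow_le_exp_mul (c := 3) (m := 2) (by norm_num) (by norm_num) (2 * n + 7)
    push_cast at this ⊢
    exact this
  have h2e : (2 : ℝ) ≤ Real.exp 1 := by have := Real.exp_one_gt_d9; linarith
  calc 2 * Real.exp (3 * ((nK + 3 : ℕ) + 1) / (2 * (2 * T'))) * (11 / 2) ^ (nK + 1) * (1 + 2 * T') ^ ((nK + 3) + (nK + 1) + 3)
      ≤ Real.exp 1 * Real.exp ((n : ℝ) + 3) * Real.exp (2 * ((n : ℝ) + 1)) * (3 * T') ^ (2 * n + 7) :=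
        mul_le_mul (mul_le_mul (mul_le_mul h2e h1 (by positivity) (by positivity)) h2 (by positivity)
          (by positivity)) h3 (by positivity) (by positivity)
    _ = Real.exp 1 * Real.exp ((n : ℝ) + 3) * Real.exp (2 * ((n : ℝ) + 1)) * 3 ^ (2 * n + 7) * T' ^ (2 * n + 7) := by
        rw [mul_pow]; ring
    _ ≤ Real.exp 1 * Real.exp ((n : ℝ) + 3) * Real.exp (2 * ((n : ℝ) + 1)) * Real.exp (2 * ((2 * n + 7 : ℕ) : ℝ)) *
          T' ^ (2 * n + 7) := by gcongr
    _ = Real.exp (7 * n + 20) * T' ^ (2 * n + 7) := by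
        have hexp : Real.exp 1 * Real.exp ((n : ℝ) + 3) * Real.exp (2 * ((n : ℝ) + 1)) *
            Real.exp (2 * ((2 * n + 7 : ℕ) : ℝ)) = Real.exp (7 * n + 20) := by
          rw [← Real.exp_add, ← Real.exp_add, ← Real.exp_add]
          congr 1
          push_cast
          ring
        rw [hexp]

/-- **`u₀ ≤ 40(n+1) log P`** under the size hypotheses (`A = 2T'`, `m = n_K + 3`, `n_K ≤ n`, `1 ≤ T' ≤ 2P`,
`|d_K| ≤ P`, `h_K ≤ P`, `P⁻¹ ≤ κ_K`, `P ≥ 2`). [folklore] -/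
theorem balancePoint_le_of_le {n : ℕ} (hn : Module.finrank ℚ K ≤ n) {P T' : ℝ} (hP : 2 ≤ P) (hT : 1 ≤ T')
    (hT2 : T' ≤ 2 * P)
    (hd : ((NumberField.discr K).natAbs : ℝ) ≤ P) (hh : (Fintype.card (ClassGroup (𝓞 K)) : ℝ) ≤ P)
    (hκ : P⁻¹ ≤ NumberField.dedekindZeta_residue K) :
    balancePoint K (2 * T') (Module.finrank ℚ K + 3) ≤ 40 * ((n : ℝ) + 1) * Real.log P := by
  set nK : ℕ := Module.finrank ℚ K with hn'
  set κ := NumberField.dedekindZeta_residue K with hκ'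
  set h : ℕ := Fintype.card (ClassGroup (𝓞 K)) with hh'
  set C := majorConst (2 * T') (nK + 3) (nK + 1) with hC
  set d : ℝ := ((NumberField.discr K).natAbs : ℝ) with hd'
  have hP0 : 0 < P := by linarith
  have hLp : Real.log 2 ≤ Real.log P := Real.log_le_log (by norm_num) hP
  have hl2 : (0.69 : ℝ) ≤ Real.log 2 := by have := Real.log_two_gt_d9; linarith
  have hl2' : Real.log 2 ≤ 0.7 := by have := Real.log_two_lt_d9; linarith
  have hLp0 : 0 < Real.log P := by linarith
  have hκ0 : 0 < κ := NumberField.dedekindZeta_residue_pos K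
  have hh0 : (0 : ℝ) < h := by rw [hh']; exact_mod_cast Fintype.card_pos
  have hC1 : 0 < C := majorConst_pos _ _ _
  have hd1 : (1 : ℝ) ≤ d := by rw [hd']; exact_mod_cast Int.natAbs_pos.mpr (NumberField.discr_ne_zero K)
  have hnr : (nK : ℝ) ≤ n := by exact_mod_cast hn
  have hn0 : (0 : ℝ) ≤ n := Nat.cast_nonneg n
  have hCle : C ≤ Real.exp (7 * n + 20) * T' ^ (2 * n + 7) := majorConst_two_mul_le_of_le hn hT
  set X : ℝ := 2 * h * d * Real.exp (2 * nK) * C / (3 * κ) with hX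
  have hX0 : 0 < X := by positivity
  have hinvκ : κ⁻¹ ≤ P := inv_le_of_inv_le₀ hP0 hκ
  have hE : Real.exp (2 * (nK : ℝ)) ≤ Real.exp (2 * n) := Real.exp_le_exp.mpr (by linarith)
  have hTpow : T' ^ (2 * n + 7) ≤ (2 * P) ^ (2 * n + 7) := pow_le_pow_left₀ (by linarith) hT2 _
  have hXle : X ≤ Real.exp (9 * n + 20) * (2 : ℝ) ^ (2 * n + 7) * P ^ (2 * n + 10) := by
    have hXeq : X = 2 * (h : ℝ) * d * Real.exp (2 * nK) * C / 3 * κ⁻¹ := by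
      rw [hX]; field_simp
    rw [hXeq]
    have h3 : (2 : ℝ) * h * d * Real.exp (2 * nK) * C / 3 ≤ h * d * Real.exp (2 * nK) * C := by
      have : 0 ≤ (h : ℝ) * d * Real.exp (2 * nK) * C := by positivity
      linarith
    calc 2 * (h : ℝ) * d * Real.exp (2 * nK) * C / 3 * κ⁻¹ ≤ (h * d * Real.exp (2 * nK) * C) * P :=
          mul_le_mul h3 hinvκ (inv_nonneg.mpr hκ0.le) (by positivity)
      _ ≤ (P * P * Real.exp (2 * n) * (Real.exp (7 * n + 20) * (2 * P) ^ (2 * n + 7))) * P := by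
          gcongr
          exact hCle.trans (mul_le_mul_of_nonneg_left hTpow (by positivity))
      _ = Real.exp (9 * n + 20) * 2 ^ (2 * n + 7) * P ^ (2 * n + 10) := by
          have hexp : Real.exp (9 * n + 20) = Real.exp (2 * n) * Real.exp (7 * n + 20) := by
            rw [← Real.exp_add]; congr 1; ring
          rw [mul_pow, hexp]; ring
  have hlogX : Real.log X ≤ (9 * n + 20) + (2 * n + 7) * Real.log 2 + (2 * n + 10) * Real.log P := by
    have h1 := Real.log_le_log hX0 hXle
    rw [Real.log_mul (by positivity) (by positivity), Real.log_mul (by positivity) (by positivity),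
      Real.log_exp, Real.log_pow, Real.log_pow] at h1
    push_cast at h1
    linarith
  rw [balancePoint, ← hn', ← hh', ← hd', ← hC, ← hκ', ← hX]
  show 2 / 3 * Real.log X ≤ 40 * ((n : ℝ) + 1) * Real.log P
  -- `9n + 20 ≤ (9n+20) log P/0.69`, `(2n+7) log 2 ≤ (2n+7) log P`
  have hA : (9 * (n : ℝ) + 20) * 0.69 ≤ (9 * (n : ℝ) + 20) * Real.log P :=
    mul_le_mul_of_nonneg_left (by linarith) (by positivity)
  have hB : (2 * (n : ℝ) + 7) * Real.log 2 ≤ (2 * (n : ℝ) + 7) * Real.log P :=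
    mul_le_mul_of_nonneg_left hLp (by positivity)
  have hnLp0 : 0 ≤ (n : ℝ) * Real.log P := by positivity
  linarith

/-- **The secondary term is `≤ e^{12n+30} P^{2n+9} N_X^{−1/(2n+4)}`** once `z^{2n+4} ≤ N_X`, `1 ≤ N_X`
(size hypotheses as in `balancePoint_le_of_le`, `A = 2T'`, `m = n_K + 3`, `n_K ≤ n`). [folklore] -/
theorem secondary_le_of_le {n : ℕ} (hn : Module.finrank ℚ K ≤ n) {P T' : ℝ} (hP : 2 ≤ P) (hT : 1 ≤ T')
    (hT2 : T' ≤ 2 * P)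
    (hd : ((NumberField.discr K).natAbs : ℝ) ≤ P) (hh : (Fintype.card (ClassGroup (𝓞 K)) : ℝ) ≤ P)
    {z NX : ℝ} (hz0 : 0 ≤ z) (hzE : z ^ (2 * n + 4) ≤ NX) (hNX : 1 ≤ NX) :
    Fintype.card (ClassGroup (𝓞 K)) * z ^ (2 * (Module.finrank ℚ K + 1)) *
        (lemma44Err K (2 * T') (Module.finrank ℚ K + 3)
          (Real.log NX - (((Module.finrank ℚ K + 3 : ℕ) : ℝ) + 1) / (2 * T')) * z) ≤
      Real.exp (12 * n + 30) * P ^ (2 * n + 9) * (NX ^ (1 / (2 * (n : ℝ) + 4)))⁻¹ := by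
  set nK : ℕ := Module.finrank ℚ K with hn'
  set h : ℕ := Fintype.card (ClassGroup (𝓞 K)) with hh'
  set C := majorConst (2 * T') (nK + 3) (nK + 1) with hC
  set d : ℝ := ((NumberField.discr K).natAbs : ℝ) with hd'
  have hP0 : 0 < P := by linarith
  have hP1 : 1 ≤ P := by linarith
  have hNX0 : 0 < NX := lt_of_lt_of_le one_pos hNX
  have hh0 : (0 : ℝ) ≤ h := Nat.cast_nonneg _
  have hd0 : 0 ≤ d := Nat.cast_nonneg _
  have hC0 : 0 < C := majorConst_pos _ _ _
  have hnr : (nK : ℝ) ≤ n := by exact_mod_cast hn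
  have hn0 : (0 : ℝ) ≤ n := Nat.cast_nonneg n
  have hCle : C ≤ Real.exp (7 * n + 20) * T' ^ (2 * n + 7) := majorConst_two_mul_le_of_le hn hT
  have hE0 : (0 : ℝ) < 2 * (n : ℝ) + 4 := by positivity
  -- `w = NX^{1/(2n+4)}`, `z ≤ w`, `1 ≤ w`
  set w : ℝ := NX ^ (1 / (2 * (n : ℝ) + 4)) with hw
  have hw0 : 0 < w := Real.rpow_pos_of_pos hNX0 _
  have hwE : w ^ (2 * n + 4) = NX := by
    rw [hw, ← Real.rpow_natCast, ← Real.rpow_mul hNX0.le]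
    have : 1 / (2 * (n : ℝ) + 4) * ((2 * n + 4 : ℕ) : ℝ) = 1 := by push_cast; field_simp
    rw [this, Real.rpow_one]
  have hzw : z ≤ w := by
    have : z ^ (2 * n + 4) ≤ w ^ (2 * n + 4) := by rw [hwE]; exact hzE
    exact le_of_pow_le_pow_left₀ (by omega) hw0.le this
  have h1w : 1 ≤ w := by
    have : (1 : ℝ) ^ (2 * n + 4) ≤ w ^ (2 * n + 4) := by rw [hwE, one_pow]; exact hNX
    exact le_of_pow_le_pow_left₀ (by omega) hw0.le this
  -- `e^{-3u/2} = e^{3(m+1)/(4T')} NX^{-3/2} ≤ e^{n+3} w^{-(3n+6)}`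
  have hu : Real.exp (-(3 / 2 * (Real.log NX - (((nK + 3 : ℕ) : ℝ) + 1) / (2 * T')))) ≤
      Real.exp ((n : ℝ) + 3) * (w ^ (3 * n + 6))⁻¹ := by
    have hsplit : -(3 / 2 * (Real.log NX - (((nK + 3 : ℕ) : ℝ) + 1) / (2 * T'))) =
        3 / 2 * ((((nK + 3 : ℕ) : ℝ) + 1) / (2 * T')) + (-(3 / 2) * Real.log NX) := by ring
    rw [hsplit, Real.exp_add]
    have h1 : Real.exp (3 / 2 * ((((nK + 3 : ℕ) : ℝ) + 1) / (2 * T'))) ≤ Real.exp ((n : ℝ) + 3) := by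
      refine Real.exp_le_exp.mpr ?_
      have : (((nK + 3 : ℕ) : ℝ) + 1) / (2 * T') ≤ ((n : ℝ) + 4) / 2 := by
        rw [div_le_div_iff₀ (by positivity) (by norm_num)]; push_cast
        have hT0 : 0 < T' := by linarith
        have : 0 ≤ ((n : ℝ) + 4) * (T' - 1) := mul_nonneg (by positivity) (by linarith)
        linarith
      linarith
    have h2 : Real.exp (-(3 / 2) * Real.log NX) = (w ^ (3 * n + 6))⁻¹ := by
      rw [show -(3 / 2) * Real.log NX = Real.log NX * (-(3 / 2)) by ring, ← Real.rpow_def_of_pos hNX0, hw,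
        ← Real.rpow_natCast, ← Real.rpow_mul hNX0.le, ← Real.rpow_neg hNX0.le]
      congr 1
      push_cast
      field_simp
      ring
    rw [h2]
    exact mul_le_mul_of_nonneg_right h1 (by positivity)
  -- `z^{2(nK+1)} z ≤ w^{2n+3}` and `w^{2n+3}/w^{3n+6} ≤ 1/w`
  have hz : z ^ (2 * (nK + 1)) * z ≤ w ^ (2 * n + 3) := by
    rw [← pow_succ]
    calc z ^ (2 * (nK + 1) + 1) ≤ w ^ (2 * (nK + 1) + 1) := pow_le_pow_left₀ hz0 hzw _
      _ ≤ w ^ (2 * n + 3) := pow_le_pow_right₀ h1w (by omega)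
  have hkey : Real.exp (-(3 / 2 * (Real.log NX - (((nK + 3 : ℕ) : ℝ) + 1) / (2 * T')))) * (z ^ (2 * (nK + 1)) * z) ≤
      Real.exp ((n : ℝ) + 3) * w⁻¹ := by
    have hsplit : w ^ (3 * n + 6) = w ^ (2 * n + 3) * w ^ (n + 3) := by
      rw [← pow_add]; congr 1; ring
    calc Real.exp (-(3 / 2 * (Real.log NX - (((nK + 3 : ℕ) : ℝ) + 1) / (2 * T')))) * (z ^ (2 * (nK + 1)) * z)
        ≤ (Real.exp ((n : ℝ) + 3) * (w ^ (3 * n + 6))⁻¹) * w ^ (2 * n + 3) :=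
          mul_le_mul hu hz (by positivity) (by positivity)
      _ = Real.exp ((n : ℝ) + 3) * (w ^ (n + 3))⁻¹ := by
          rw [hsplit]; field_simp
      _ ≤ Real.exp ((n : ℝ) + 3) * w⁻¹ := by
          refine mul_le_mul_of_nonneg_left ?_ (by positivity)
          exact inv_anti₀ hw0 (le_self_pow₀ h1w (by omega))
  have hE : Real.exp (2 * (nK : ℝ)) ≤ Real.exp (2 * n) := Real.exp_le_exp.mpr (by linarith)
  have hTpow : T' ^ (2 * n + 7) ≤ (2 * P) ^ (2 * n + 7) := pow_le_pow_left₀ (by linarith) hT2 _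
  have h2pow : (2 : ℝ) ^ (2 * n + 7) ≤ Real.exp ((2 * n + 7 : ℕ) : ℝ) := by
    have := pow_le_exp_mul (c := 2) (m := 1) (by norm_num) (by norm_num) (2 * n + 7)
    simpa using this
  rw [lemma44Err, ← hd', ← hC]
  calc (h : ℝ) * z ^ (2 * (nK + 1)) *
        (1 / 3 * (d * Real.exp (2 * nK)) * C * Real.exp (-(3 / 2 * (Real.log NX - (((nK + 3 : ℕ) : ℝ) + 1) / (2 * T')))) * z)
      = 1 / 3 * (h * d * Real.exp (2 * nK) * C) *
          (Real.exp (-(3 / 2 * (Real.log NX - (((nK + 3 : ℕ) : ℝ) + 1) / (2 * T')))) * (z ^ (2 * (nK + 1)) * z)) := by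
        ring
    _ ≤ 1 / 3 * (P * P * Real.exp (2 * n) * (Real.exp (7 * n + 20) * (2 * P) ^ (2 * n + 7))) *
          (Real.exp ((n : ℝ) + 3) * w⁻¹) := by
        gcongr
        exact hCle.trans (mul_le_mul_of_nonneg_left hTpow (by positivity))
    _ = (1 / 3 * 2 ^ (2 * n + 7)) * (Real.exp (2 * n) * Real.exp (7 * n + 20) * Real.exp ((n : ℝ) + 3)) *
          P ^ (2 * n + 9) * w⁻¹ := by
        rw [mul_pow]; ring
    _ ≤ (1 * Real.exp ((2 * n + 7 : ℕ) : ℝ)) * (Real.exp (2 * n) * Real.exp (7 * n + 20) * Real.exp ((n : ℝ) + 3)) *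
          P ^ (2 * n + 9) * w⁻¹ := by
        have HH : 1 / 3 * (2 : ℝ) ^ (2 * n + 7) ≤ 1 * Real.exp ((2 * n + 7 : ℕ) : ℝ) :=
          mul_le_mul (by norm_num) h2pow (by positivity) (by norm_num)
        exact mul_le_mul_of_nonneg_right (mul_le_mul_of_nonneg_right
          (mul_le_mul_of_nonneg_right HH (by positivity)) (by positivity)) (by positivity)
    _ = Real.exp (12 * n + 30) * P ^ (2 * n + 9) * w⁻¹ := by
        have hexp : Real.exp ((2 * n + 7 : ℕ) : ℝ) * (Real.exp (2 * n) * Real.exp (7 * n + 20) * Real.exp ((n : ℝ) + 3)) =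
            Real.exp (12 * n + 30) := by
          rw [← Real.exp_add, ← Real.exp_add, ← Real.exp_add]
          congr 1
          push_cast
          ring
        rw [one_mul, hexp]

/-! ### `log t ≤ t/M` for `t ≥ 4M²`, `log 480 ≤ 6.5` -/

/-- `log 480 ≤ 6.5`. [folklore] -/
theorem log_480_le : Real.log 480 ≤ 6.5 := by
  rw [show (480 : ℝ) = 2 ^ 5 * 15 by norm_num, Real.log_mul (by norm_num) (by norm_num), Real.log_pow]
  have := Real.log_two_lt_d9
  have h15 : Real.log 15 ≤ 3 := by
    have : Real.log 15 ≤ Real.log (Real.exp 3) := by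
      refine Real.log_le_log (by norm_num) ?_
      have h1 : Real.exp 3 = Real.exp 1 * Real.exp 1 * Real.exp 1 := by rw [← Real.exp_add, ← Real.exp_add]; norm_num
      have := Real.exp_one_gt_d9
      rw [h1]; nlinarith [Real.exp_pos (1:ℝ)]
    rwa [Real.log_exp] at this
  norm_num; linarith

/-- `log t ≤ t/M` for `0 < M` and `4M² ≤ t` (`log t ≤ 2√t` and `2M ≤ √t`). [folklore] -/
theorem log_le_div_of_sq_le {M t : ℝ} (hM : 0 < M) (ht : 4 * M ^ 2 ≤ t) : Real.log t ≤ t / M := by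
  have ht0 : 0 < t := lt_of_lt_of_le (by positivity) ht
  set s : ℝ := t ^ ((1 : ℝ) / 2) with hs
  have hs0 : 0 ≤ s := Real.rpow_nonneg ht0.le _
  have hss : s * s = t := by
    rw [hs, ← Real.rpow_add ht0]; norm_num
  have hlog : Real.log t ≤ 2 * s := by
    have := Real.log_le_rpow_div ht0.le (show (0 : ℝ) < 1 / 2 by norm_num)
    rw [← hs] at this
    linarith
  have h2M : 2 * M ≤ s := by
    have : (2 * M) ^ 2 ≤ s ^ 2 := by nlinarith
    exact le_of_pow_le_pow_left₀ two_ne_zero hs0 this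
  rw [le_div_iff₀ hM]
  nlinarith

/-! ### The packaged saving -/

set_option maxHeartbeats 800000 in
/-- **The mean value constant with the sieve parameter `z = ⌊N_X^{1/(2n+4)}⌋`, every degree**: there are
`D, C_M > 0` depending only on `n` such that for `n_K ≤ n`, `P ≥ 2` with `|d_K| ≤ P`, `h_K ≤ P`,
`κ_K ≥ 1/P`, `1 ≤ T' ≤ 2P`, `a₀ L_x ≥ D log P`, and `x^{a₀}/2 ≤ N_X ≤ x^{a₀}` (`x = e^{L_x}`,
`a₀ = expoB`), the integer `z = ⌊N_X^{1/(2n+4)}⌋` satisfies `1 ≤ z ≤ N_X`, `z ≤ x^{a₀/2}`, and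
`h_K · M(2T', n_K+3, z, N_X) ≤ C_M/L_x` (`card_mul_meanValueConst_le` at the balancing point `u₀`, with
`log z − u₀ − (m+1)/(2T') ≥ a₀ L_x/(4n+8)` and the secondary term `≤ 1/L_x`).
[cite: ThornerZaman2017, Theorem 4.2] -/
theorem card_mul_meanValueConst_le_param (n : ℕ) :
    ∃ D C_M : ℝ, 0 < D ∧ 0 < C_M ∧
      ∀ (K : Type*) [Field K] [NumberField K], Module.finrank ℚ K ≤ n →
      ∀ (P T' Lx : ℝ), 2 ≤ P → ((NumberField.discr K).natAbs : ℝ) ≤ P →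
        (Fintype.card (ClassGroup (𝓞 K)) : ℝ) ≤ P → P⁻¹ ≤ NumberField.dedekindZeta_residue K →
        1 ≤ T' → T' ≤ 2 * P → D * Real.log P ≤ expoB * Lx →
        ∀ (NX z : ℕ), (NX : ℝ) ≤ Real.exp Lx ^ expoB → Real.exp Lx ^ expoB / 2 ≤ NX →
          z = ⌊(NX : ℝ) ^ (1 / (2 * (n : ℝ) + 4))⌋₊ →
          1 ≤ z ∧ z ≤ NX ∧ (z : ℝ) ≤ Real.exp Lx ^ (expoB / 2) ∧
          (Fintype.card (ClassGroup (𝓞 K)) : ℝ) * meanValueConst K (2 * T') (Module.finrank ℚ K + 3) z NX ≤ C_M / Lx := by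
  set a : ℝ := expoB with ha
  have hapos : 0 < a := expoB_pos
  have ha1 : a ≤ 1 / 2 := expoB_le_half
  have hn0 : (0 : ℝ) ≤ n := Nat.cast_nonneg n
  set E : ℝ := 2 * (n : ℝ) + 4 with hE
  have hE0 : 0 < E := by positivity
  have hE4 : 4 ≤ E := by rw [hE]; linarith
  set D : ℝ := 2 * E * (41 * n + 90) + 2200 with hD
  have hDpos : 0 < D := by positivity
  set C_M : ℝ := 16 * ((n : ℝ) + 2) * ((n : ℝ) + 4) * Real.exp n / a + 1 with hC_M
  have hC_Mpos : 0 < C_M := by positivity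
  refine ⟨D, C_M, hDpos, hC_Mpos, fun K _ _ hnK P T' Lx hP hd hh hκ hT'1 hT'2 hDLx NX z hNXle hNXhalf hzdef => ?_⟩
  /- ── sizes ── -/
  have hPpos : 0 < P := by linarith
  have hP1 : 1 ≤ P := by linarith
  set Lp : ℝ := Real.log P with hLp
  have hLp2 : Real.log 2 ≤ Lp := Real.log_le_log (by norm_num) hP
  have hlog2 : (0.69 : ℝ) ≤ Real.log 2 := by have := Real.log_two_gt_d9; linarith
  have hlog2' : Real.log 2 ≤ 0.7 := by have := Real.log_two_lt_d9; linarith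
  have hLppos : 0 < Lp := by linarith
  have hLp69 : (0.69 : ℝ) ≤ Lp := by linarith
  set t : ℝ := a * Lx with ht
  have htE : 2 * E * (41 * n + 90) * Lp ≤ t := by
    have : 2 * E * (41 * n + 90) * Lp ≤ D * Lp := mul_le_mul_of_nonneg_right (by rw [hD]; linarith) hLppos.le
    linarith
  have hq : (41 * (n : ℝ) + 90) * Lp ≤ t / (2 * E) := by
    rw [le_div_iff₀ (by positivity)]; linarith
  have ht2200 : 2200 * Lp ≤ t := by
    have hD' : (2200 : ℝ) ≤ D := by
      rw [hD]; have : 0 ≤ 2 * E * (41 * n + 90) := by positivity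
      linarith
    have : 2200 * Lp ≤ D * Lp := mul_le_mul_of_nonneg_right hD' hLppos.le
    linarith
  have ht1500 : 1500 ≤ t := by
    have := mul_le_mul_of_nonneg_left hLp69 (show (0 : ℝ) ≤ 2200 by norm_num)
    linarith
  have htpos : 0 < t := by linarith
  have hLxpos : 0 < Lx := by
    have h : a * 0 < a * Lx := by rw [mul_zero]; linarith
    exact lt_of_mul_lt_mul_left h hapos.le
  /- ── `x^{a}`, `NX` ── -/
  have hxa : Real.exp Lx ^ a = Real.exp t := by rw [ht, ← Real.exp_mul, mul_comm]
  have hxpos : 0 < Real.exp Lx := Real.exp_pos _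
  have hxa512 : (512 : ℝ) ≤ Real.exp Lx ^ a := by
    rw [hxa]; linarith [Real.add_one_le_exp t]
  have hNX256 : (256 : ℝ) ≤ NX := by linarith
  have hNX1 : 1 ≤ NX := by exact_mod_cast (show (1 : ℝ) ≤ NX by linarith)
  have hNXpos : (0 : ℝ) < NX := by linarith
  have hlogNX : t - 1 ≤ Real.log NX := by
    have h1 : Real.log (Real.exp Lx ^ a / 2) ≤ Real.log NX := Real.log_le_log (by positivity) hNXhalf
    rw [Real.log_div (by positivity) two_ne_zero, hxa, Real.log_exp] at h1
    linarith
  /- ── `w = NX^{1/E}`, `z = ⌊w⌋` ── -/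
  set w : ℝ := (NX : ℝ) ^ (1 / E) with hw
  have hw0 : 0 < w := Real.rpow_pos_of_pos hNXpos _
  have hwE : w ^ (2 * n + 4) = NX := by
    rw [hw, ← Real.rpow_natCast, ← Real.rpow_mul hNXpos.le]
    have hcast : ((2 * n + 4 : ℕ) : ℝ) = E := by rw [hE]; push_cast; ring
    rw [hcast, one_div, inv_mul_cancel₀ hE0.ne', Real.rpow_one]
  have hlogw : Real.log w = Real.log NX / E := by
    rw [hw, Real.log_rpow hNXpos]; ring
  have hlogw_low : (t - 1) / E ≤ Real.log w := by
    rw [hlogw]; exact div_le_div_of_nonneg_right hlogNX hE0.le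
  have hE_inv : 1 / E ≤ 1 / 4 := one_div_le_one_div_of_le (by norm_num) hE4
  have htE' : t / E = 2 * (t / (2 * E)) := by field_simp
  have hlogw_low' : 2 * (t / (2 * E)) - 1 / E ≤ Real.log w := by
    have h1 : (t - 1) / E = t / E - 1 / E := by rw [sub_div]
    rw [h1, htE'] at hlogw_low
    exact hlogw_low
  have h90 : 90 * Lp ≤ (41 * (n : ℝ) + 90) * Lp :=
    mul_le_mul_of_nonneg_right (by linarith) hLppos.le
  have hlogw1 : 1 ≤ Real.log w := by linarith
  have hw2 : 2 ≤ w := by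
    have : Real.log 2 ≤ Real.log w := by linarith
    exact (Real.log_le_log_iff (by norm_num) hw0).1 this
  have hzdef' : z = ⌊w⌋₊ := hzdef
  have hzle : (z : ℝ) ≤ w := by rw [hzdef']; exact Nat.floor_le hw0.le
  have hzgt : w < z + 1 := by rw [hzdef']; exact Nat.lt_floor_add_one _
  have hz1 : 1 ≤ z := by rw [hzdef']; exact Nat.le_floor (by simp only [Nat.cast_one]; linarith)
  have hz1r : (1 : ℝ) ≤ z := by exact_mod_cast hz1
  have hzpos : (0 : ℝ) < z := by linarith
  have hzhalfw : w / 2 ≤ z := by linarith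
  have hlogz : 2 * (t / (2 * E)) - 1 / E - 0.7 ≤ Real.log z := by
    have h1 : Real.log (w / 2) ≤ Real.log z := Real.log_le_log (by positivity) hzhalfw
    rw [Real.log_div hw0.ne' two_ne_zero] at h1
    linarith
  have hzE : (z : ℝ) ^ (2 * n + 4) ≤ NX := by
    calc (z : ℝ) ^ (2 * n + 4) ≤ w ^ (2 * n + 4) := pow_le_pow_left₀ (Nat.cast_nonneg z) hzle _
      _ = NX := hwE
  have hw_le_NX : w ≤ NX := by
    rw [hw]
    calc (NX : ℝ) ^ (1 / E) ≤ (NX : ℝ) ^ (1 : ℝ) :=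
          Real.rpow_le_rpow_of_exponent_le (by exact_mod_cast hNX1) (by linarith)
      _ = NX := Real.rpow_one _
  have hzNX : z ≤ NX := by exact_mod_cast hzle.trans hw_le_NX
  have hzhalf : (z : ℝ) ≤ Real.exp Lx ^ (a / 2) := by
    calc (z : ℝ) ≤ w := hzle
      _ = (NX : ℝ) ^ (1 / E) := hw
      _ ≤ (NX : ℝ) ^ ((1 : ℝ) / 2) := Real.rpow_le_rpow_of_exponent_le (by exact_mod_cast hNX1) (by linarith)
      _ ≤ (Real.exp Lx ^ a) ^ ((1 : ℝ) / 2) := Real.rpow_le_rpow (Nat.cast_nonneg _) hNXle (by norm_num)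
      _ = Real.exp Lx ^ (a / 2) := by rw [← Real.rpow_mul hxpos.le]; ring_nf
  /- ── kernel parameters `A = 2T'`, `m = n_K + 3`, balancing point ── -/
  set nK : ℕ := Module.finrank ℚ K with hnK'
  set m : ℕ := nK + 3 with hm
  have hm3 : Module.finrank ℚ K + 3 ≤ m := le_rfl
  have hnKn : (nK : ℝ) ≤ n := by exact_mod_cast hnK
  have hnK0 : (0 : ℝ) ≤ nK := Nat.cast_nonneg _
  have hmcast : (m : ℝ) = nK + 3 := by rw [hm]; push_cast; ring
  have hA2 : 0 < 2 * T' := by positivity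
  have hmA : ((m : ℝ) + 1) / (2 * T') ≤ ((n : ℝ) + 4) / 2 := by
    rw [div_le_div_iff₀ hA2 (by norm_num), hmcast]
    have : 0 ≤ ((n : ℝ) + 4) * (T' - 1) := mul_nonneg (by positivity) (by linarith)
    linarith
  obtain ⟨u₀, hu₀def⟩ : ∃ u : ℝ, u = balancePoint K (2 * T') m := ⟨_, rfl⟩
  have hu₀ : Fintype.card (ClassGroup (𝓞 K)) * lemma44Err K (2 * T') m u₀ ≤ NumberField.dedekindZeta_residue K / 2 := by
    rw [hu₀def]; exact (card_mul_lemma44Err_balancePoint (K := K) (2 * T') m).le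
  have hu₀le : u₀ ≤ 40 * ((n : ℝ) + 1) * Lp := by
    rw [hu₀def]; exact balancePoint_le_of_le hnK hP hT'1 hT'2 hd hh hκ
  -- the saving denominator
  have hnLp : ((n : ℝ) + 50) * 0.69 ≤ ((n : ℝ) + 50) * Lp := mul_le_mul_of_nonneg_left hLp69 (by positivity)
  have hden : t / (2 * E) + 1 ≤ Real.log z - u₀ - ((m : ℝ) + 1) / (2 * T') := by
    linarith
  have hden1 : 1 ≤ Real.log z - u₀ - ((m : ℝ) + 1) / (2 * T') := by
    have : 0 ≤ t / (2 * E) := by positivity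
    linarith
  have hdenpos : 0 < Real.log z - u₀ - ((m : ℝ) + 1) / (2 * T') := by linarith
  /- ── `h_K M ≤ C_M/Lx` ── -/
  have h1 := card_mul_meanValueConst_le (K := K) hA2 hm3 hz1r (NX : ℝ) hu₀ hden1
  have h2 := secondary_le_of_le (K := K) hnK hP hT'1 hT'2 hd hh hzpos.le hzE (by exact_mod_cast hNX1)
  rw [← hw] at h2
  -- main term
  have hmain : 4 * ((m : ℝ) + 1) * Real.exp nK / (Real.log z - u₀ - ((m : ℝ) + 1) / (2 * T')) ≤
      16 * ((n : ℝ) + 2) * ((n : ℝ) + 4) * Real.exp n / a / Lx := by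
    have hnum : 4 * ((m : ℝ) + 1) * Real.exp nK ≤ 4 * ((n : ℝ) + 4) * Real.exp n := by
      have he : Real.exp (nK : ℝ) ≤ Real.exp n := Real.exp_le_exp.mpr hnKn
      have h0 : 0 ≤ Real.exp (nK : ℝ) := (Real.exp_pos _).le
      rw [hmcast]
      have h5 : ((nK : ℝ) + 3 + 1) * Real.exp (nK : ℝ) ≤ ((n : ℝ) + 4) * Real.exp n :=
        mul_le_mul (by linarith) he h0 (by positivity)
      linarith
    have hden' : t / (2 * E) ≤ Real.log z - u₀ - ((m : ℝ) + 1) / (2 * T') := by linarith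
    have h3 : 4 * ((m : ℝ) + 1) * Real.exp nK / (Real.log z - u₀ - ((m : ℝ) + 1) / (2 * T')) ≤
        4 * ((n : ℝ) + 4) * Real.exp n / (t / (2 * E)) := div_le_div₀ (by positivity) hnum (by positivity) hden'
    refine h3.trans (le_of_eq ?_)
    rw [ht, hE]
    field_simp [hapos.ne', hLxpos.ne']
    ring
  -- secondary term: `w ≥ e^{12n+30} P^{2n+9} Lx`
  have hsec : Real.exp (12 * n + 30) * P ^ (2 * n + 9) * w⁻¹ ≤ 1 / Lx := by
    -- `log Lx = log t + log 480 + 14`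
    have hlogLx : Real.log Lx = Real.log t + Real.log 480 + 14 := by
      have : Real.log t = Real.log a + Real.log Lx := by rw [ht, Real.log_mul hapos.ne' hLxpos.ne']
      rw [this, ha, expoB, one_div, Real.log_inv, Real.log_mul (by norm_num) (Real.exp_pos _).ne', Real.log_exp]
      ring
    have h480 : Real.log 480 ≤ 6.5 := log_480_le
    -- `log t ≤ t/(2E)` as `t ≥ 16 E²`
    have ht16 : 4 * (2 * E) ^ 2 ≤ t := by
      have h1 : 16 * E ≤ (41 * n + 90) * 0.69 * 2 := by rw [hE]; linarith
      have h2 : (41 * (n : ℝ) + 90) * 0.69 ≤ (41 * (n : ℝ) + 90) * Lp := mul_le_mul_of_nonneg_left hLp69 (by positivity)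
      have h3 : E * (16 * E) ≤ E * ((41 * n + 90) * 0.69 * 2) := mul_le_mul_of_nonneg_left h1 hE0.le
      have h4 : 2 * E * ((41 * (n : ℝ) + 90) * 0.69) ≤ 2 * E * ((41 * (n : ℝ) + 90) * Lp) :=
        mul_le_mul_of_nonneg_left h2 (by positivity)
      linarith [h3, h4, htE]
    have hlogt : Real.log t ≤ t / (2 * E) := log_le_div_of_sq_le (by positivity) ht16
    have h9Lp : (39 * (n : ℝ) + 81) * 0.69 ≤ (39 * (n : ℝ) + 81) * Lp := mul_le_mul_of_nonneg_left hLp69 (by positivity)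
    have hwlow : Real.exp (12 * n + 30) * P ^ (2 * n + 9) * Lx ≤ w := by
      have h3 : Real.log (Real.exp (12 * n + 30) * P ^ (2 * n + 9) * Lx) ≤ Real.log w := by
        rw [Real.log_mul (by positivity) hLxpos.ne', Real.log_mul (by positivity) (by positivity), Real.log_exp,
          Real.log_pow, hlogLx]
        push_cast
        linarith
      exact (Real.log_le_log_iff (by positivity) hw0).mp h3
    have hinv : w⁻¹ ≤ (Real.exp (12 * n + 30) * P ^ (2 * n + 9) * Lx)⁻¹ := inv_anti₀ (by positivity) hwlow
    calc Real.exp (12 * n + 30) * P ^ (2 * n + 9) * w⁻¹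
        ≤ Real.exp (12 * n + 30) * P ^ (2 * n + 9) * (Real.exp (12 * n + 30) * P ^ (2 * n + 9) * Lx)⁻¹ :=
          mul_le_mul_of_nonneg_left hinv (by positivity)
      _ = 1 / Lx := by field_simp
  have hM : (Fintype.card (ClassGroup (𝓞 K)) : ℝ) * meanValueConst K (2 * T') m z NX ≤ C_M / Lx := by
    calc (Fintype.card (ClassGroup (𝓞 K)) : ℝ) * meanValueConst K (2 * T') m z NX
        ≤ _ := h1
      _ ≤ 16 * ((n : ℝ) + 2) * ((n : ℝ) + 4) * Real.exp n / a / Lx + 1 / Lx := add_le_add hmain (h2.trans hsec)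
      _ = C_M / Lx := by rw [hC_M, add_div]
  exact ⟨hz1, hzNX, hzhalf, hM⟩

end Literature.NumberTheory.LFunctions.NumberField

end
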